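import Summits.Ventures.HodgeRepro.Night1WeilLineEigen
import Summits.Ventures.HodgeRepro.Night1ProductDischarge

/-!
# Lemma R's combinatorial core at every level `k`: the reduced sets of a `SumP k` corner family are Pohlmann
sets of the reduced product, on `J × G` and on the coset `G`-set of `B_red`, with their eigenspace forms

Blind re-derivation cell `pub-hodge-repro`, seat `night-1` (gen 3).  Imports g0's `Night1WeilLineEigen` (p375263:
the reduced-side enumeration `weilEnum` on the coset `G`-set; transitively `RouteCCosetModel` / `RouteCClauses`)
and g2's `Night1ProductDischarge` (p375885: `SumP`).

typer's `FaceReduce.isHodgeSetProd_reducedSet` (the combinatorial core of Lemma R, S3ᴿ) and g0's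
`RouteCCosetModel.isHodgeSetOn_cosetMap_reducedSet` / `Night1WeilLineEigen.weilWedge_mem_jointEigenspaceOn` are
stated for `SumTwo` families (rank-four faces, `k = 2`).  Nothing in their proofs needs `k = 2`: for a corner family
`T i = Φ (cls i) · tw i` with pairwise distinct `(cls i, tw i)` and **every embedding in exactly `k` corners**
(`SumP k`, ROUTE.md §3.6's level-`k` condition), the reduced set `U_σ = {(cls i, σ (tw i)⁻¹)}` of typer's
`FaceReduce.reducedSet` at every `σ ∈ G` is a Pohlmann set of the product `∏_k A_{Φ k}` of the representatives,
and its image on the coset `G`-set of `B_red = ∏_k Simple (Φ k)` is a Pohlmann set of `cosetType Φ`.  This file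
states the level-`k` forms:

* `twistMap cls tw : ι × G → J × G`, `(i, x) ↦ (cls i, x (tw i)⁻¹)` — the embedding-level shadow of the twist
  isogenies `A_{Φ · tw} ∼ A_Φ`; **`isHodgeSetProd_image_twistMap_iff`** — transfer of Pohlmann's product
  criterion along it (`θ(Δ)` is Pohlmann for `Φ` iff `Δ` is Pohlmann for the corners, `θ` injective on `Δ`) —
  the product-side companion of typer's `IsTypeMap.isHodgeSetOn_image_iff`; its bijective case `ι = J`,
  `cls = id` is route-2 g19's `isHodgeSetProd_rmul_iff` (route/route2-g19/RmulReindex.lean, ROUTE.md §3.5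
  [v2.31], not in the tree);
* **`isHodgeSetProd_reducedSet_of_sumP`** — the level-`k` form of typer's `isHodgeSetProd_reducedSet`
  (whose proof it follows word for word, `2` replaced by `k`); `isHodgeSetProd_reducedSet_of_sumTwo` = typer's;
* `reducedEnum cls tw e σ : Fin (2k) → J × G` — the enumeration `j ↦ (cls (e j), σ (tw (e j))⁻¹)` of `U_σ`
  through an enumeration `e : Fin (2k) ≃ ι` of the corners; **`reducedWedge_mem_jointEigenspaceOn`** — its
  coordinate wedge is a joint `(k, k)`-eigenvector of every conjugate cocharacter of `∏_k A_{Φ k}` (typer-2's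
  dictionary `isHodgeSetProd_iff_forall_map_cocharOn_eq`);
* **`isHodgeSetOn_cosetMap_reducedSet_of_sumP`** — g0's `isHodgeSetOn_cosetMap_reducedSet` at every level (typer's
  `IsTypeMap` transfer along `cosetMap Φ`); `cosetEnum Φ cls tw e σ = cosetMap Φ ∘ reducedEnum cls tw e σ`
  (= g0's `weilEnum` for `k = 2`, `ι = Fin 4`, `e = Equiv.refl`: `weilEnum_eq_cosetEnum`, by `rfl`);
  **`cosetWedge_mem_jointEigenspaceOn`** — g0's `weilWedge_mem_jointEigenspaceOn` at every level: the
  coordinate wedge of `cosetMap Φ (U_σ)` is a joint `(k, k)`-eigenvector of `⋀^{2k} μ_{g • cosetType Φ}(λ)`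
  for all `g`, `λ` — the `σ`-line of `W_F(B)` read on `B_red`, in codimension `k`.

Where it bites: the level-3 families with pairwise DISTINCT corners — typer g5's decic witness (ROUTE.md
§3.6 (iii), six distinct primitive corners) — have Lemma R's combinatorial core available exactly as the faces
do; the 24-fold `B₃` (a repeated corner) does not (injectivity fails), which is why g2 discharged it without
reduction.  Nothing geometric is built (the isogenies are named, not constructed).  Nothing here says anything
about the status of the Hodge conjecture for CM abelian varieties, which is NOT proved.
-/

set_option autoImplicit false

open Finset
open scoped Pointwise

namespace HodgeRepro.RouteC

open CMHodgeOn

variable {G : Type*} [Group G] [DecidableEq G] [Fintype G] {ι J : Type*} [Fintype ι] [DecidableEq ι]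
  [DecidableEq J]

/-! ### The twist map and the transfer of Pohlmann's product criterion -/

/-- The **twist map** `(i, x) ↦ (cls i, x · (tw i)⁻¹)` from the embeddings of `F^ι` (the full corner product
`∏_i A_{Φ (cls i) · tw i}`) to the embeddings of `F^J` (the product `∏_k A_{Φ k}` of the representatives):
the shadow on embeddings of the twist isogenies `A_{Φ · tw} ∼ A_Φ`. -/
def twistMap (cls : ι → J) (tw : ι → G) : ι × G → J × G := fun q => (cls q.1, q.2 * (tw q.1)⁻¹)

omit [DecidableEq G] [Fintype G] [Fintype ι] [DecidableEq ι] [DecidableEq J] in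
/-- The twist map, unfolded. -/
@[simp] theorem twistMap_apply (cls : ι → J) (tw : ι → G) (q : ι × G) :
    twistMap cls tw q = (cls q.1, q.2 * (tw q.1)⁻¹) := rfl

omit [Fintype G] [Fintype ι] [DecidableEq ι] in
/-- Counting after the twist map: for `θ` injective on `Δ`, `#{q ∈ θ(Δ) : τ q.2 ∈ S q.1} =
#{q ∈ Δ : τ q.2 ∈ corner S cls tw q.1}` for any family `S : J → Finset G` (`S` and its conjugate at once). -/
theorem card_filter_image_twistMap (cls : ι → J) (tw : ι → G) {Δ : Finset (ι × G)}
    (hinj : Set.InjOn (twistMap cls tw) Δ) (S : J → Finset G) (τ : G) :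
    ((Δ.image (twistMap cls tw)).filter fun q => τ * q.2 ∈ S q.1).card =
      (Δ.filter fun q => τ * q.2 ∈ corner S cls tw q.1).card := by
  rw [Finset.filter_image, card_image_of_injOn (hinj.mono (Finset.coe_subset.2 (filter_subset _ _)))]
  refine congrArg Finset.card (filter_congr fun q _ => ?_)
  rw [twistMap_apply, mem_corner, mul_assoc]

omit [Fintype G] [Fintype ι] [DecidableEq ι] in
/-- **Transfer of Pohlmann's product criterion along the twist map**: for `Δ ⊆ ι × G` on which `θ` is
injective, `θ(Δ)` satisfies typer's product criterion for the representatives `Φ` iff `Δ` satisfies it for the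
corners `corner Φ cls tw` — the product-side companion of typer's `IsTypeMap.isHodgeSetOn_image_iff`.  The
case `ι = J`, `cls = id` (a bijective reindexing of one product) is route-2 g19's `isHodgeSetProd_rmul_iff`
(route/route2-g19/RmulReindex.lean, ROUTE.md §3.5 [v2.31]; not in the tree); here the class map `cls` may
identify corners, so the map is only injective on the sets that matter. -/
theorem isHodgeSetProd_image_twistMap_iff {c : G} (hc : IsComplexConj c) (Φ : J → Finset G) (cls : ι → J)
    (tw : ι → G) {Δ : Finset (ι × G)} (hinj : Set.InjOn (twistMap cls tw) Δ) :
    IsHodgeSetProd c Φ (Δ.image (twistMap cls tw)) ↔ IsHodgeSetProd c (corner Φ cls tw) Δ := by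
  unfold IsHodgeSetProd
  refine forall_congr' fun τ => ?_
  rw [card_filter_image_twistMap cls tw hinj Φ τ, card_filter_image_twistMap cls tw hinj (fun k => c • Φ k) τ]
  have key : (Δ.filter fun q => τ * q.2 ∈ corner (fun k => c • Φ k) cls tw q.1) =
      Δ.filter fun q => τ * q.2 ∈ c • corner Φ cls tw q.1 := by
    refine filter_congr fun q _ => ?_
    rw [mem_corner, hc.mem_smul_iff, hc.mem_smul_iff, mem_corner]
    simp only [mul_assoc]
  rw [key]

/-! ### Lemma R's combinatorial core at level `k` on `J × G` -/

omit [Fintype G] [DecidableEq ι] in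
/-- **The level-`k` form of typer's `isHodgeSetProd_reducedSet`** (Lemma R's combinatorial core; typer's is
`k = 2`): for a corner family `corner Φ cls tw` with pairwise distinct `(cls, tw)` and every embedding in exactly
`k` corners, the reduced set `U_σ` at every `σ` satisfies Pohlmann's product criterion for `(Φ k)_k`: exactly `k`
of its elements `(k, y)` have `τ y ∈ Φ k`, and exactly `k` have `τ y ∈ c Φ k`. -/
theorem isHodgeSetProd_reducedSet_of_sumP {c : G} (hc : IsComplexConj c) (Φ : J → Finset G)
    {cls : ι → J} {tw : ι → G} (hinj : Function.Injective fun i => (cls i, tw i)) {k : ℕ}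
    (hsum : SumP k (corner Φ cls tw)) (σ : G) : IsHodgeSetProd c Φ (reducedSet cls tw σ) := by
  intro τ
  rw [card_filter_reducedSet cls tw hinj, card_filter_reducedSet cls tw hinj]
  have key : ∀ (x : G) (i : ι), x * (σ * (tw i)⁻¹) ∈ Φ (cls i) ↔ x * σ ∈ corner Φ cls tw i := by
    intro x i
    rw [mem_corner, mul_assoc]
  have h1 : (univ.filter fun i => τ * (σ * (tw i)⁻¹) ∈ Φ (cls i)).card = k := by
    simp only [key]
    exact hsum (τ * σ)
  have h2 : (univ.filter fun i => τ * (σ * (tw i)⁻¹) ∈ c • Φ (cls i)).card = k := by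
    have key' : ∀ i, τ * (σ * (tw i)⁻¹) ∈ c • Φ (cls i) ↔ c * τ * σ ∈ corner Φ cls tw i := by
      intro i
      rw [hc.mem_smul_iff, ← mul_assoc, key]
    simp only [key']
    exact hsum (c * τ * σ)
  rw [h1, h2]

omit [Fintype G] [DecidableEq ι] in
/-- typer's `isHodgeSetProd_reducedSet` (`SumTwo`, `k = 2`) as the instance `k = 2`. -/
theorem isHodgeSetProd_reducedSet_of_sumTwo {c : G} (hc : IsComplexConj c) (Φ : J → Finset G)
    {cls : ι → J} {tw : ι → G} (hinj : Function.Injective fun i => (cls i, tw i))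
    (hsum : SumTwo (corner Φ cls tw)) (σ : G) : IsHodgeSetProd c Φ (reducedSet cls tw σ) :=
  isHodgeSetProd_reducedSet_of_sumP hc Φ hinj (k := 2) hsum σ

/-- The enumeration of the reduced set `U_σ` by `Fin (2k)` through an enumeration `e : Fin (2k) ≃ ι` of the
corners: `j ↦ (cls (e j), σ (tw (e j))⁻¹)`. -/
def reducedEnum (cls : ι → J) (tw : ι → G) {k : ℕ} (e : Fin (2 * k) ≃ ι) (σ : G) : Fin (2 * k) → J × G :=
  fun j => (cls (e j), σ * (tw (e j))⁻¹)

omit [DecidableEq G] [Fintype G] [Fintype ι] [DecidableEq ι] [DecidableEq J] in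
/-- The enumeration, unfolded. -/
@[simp] theorem reducedEnum_apply (cls : ι → J) (tw : ι → G) {k : ℕ} (e : Fin (2 * k) ≃ ι) (σ : G)
    (j : Fin (2 * k)) : reducedEnum cls tw e σ j = (cls (e j), σ * (tw (e j))⁻¹) := rfl

omit [DecidableEq G] [Fintype G] [Fintype ι] [DecidableEq ι] [DecidableEq J] in
/-- The enumeration is injective when `(cls, tw)` is. -/
theorem reducedEnum_injective {cls : ι → J} {tw : ι → G}
    (hinj : Function.Injective fun i => (cls i, tw i)) {k : ℕ} (e : Fin (2 * k) ≃ ι) (σ : G) :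
    Function.Injective (reducedEnum cls tw e σ) := by
  intro j j' h
  simp only [reducedEnum_apply, Prod.mk.injEq, mul_left_cancel_iff, inv_inj] at h
  exact e.injective (hinj (Prod.ext h.1 h.2))

omit [Fintype G] [DecidableEq ι] in
/-- The image of the enumeration is the reduced set. -/
theorem image_reducedEnum (cls : ι → J) (tw : ι → G) {k : ℕ} (e : Fin (2 * k) ≃ ι) (σ : G) :
    univ.image (reducedEnum cls tw e σ) = reducedSet cls tw σ := by
  ext q
  simp only [reducedEnum_apply, mem_image, mem_univ, true_and, mem_reducedSet]
  constructor
  · rintro ⟨j, rfl⟩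
    exact ⟨e j, rfl⟩
  · rintro ⟨i, rfl⟩
    exact ⟨e.symm i, by rw [Equiv.apply_symm_apply]⟩

omit [DecidableEq ι] in
/-- **The level-`k` eigenspace form on `J × G`**: for a `SumP k` corner family with pairwise distinct
`(cls, tw)`, the coordinate wedge of the enumeration of `U_σ` — the `σ`-line of `W_F(B)` read on the product
`∏_k A_{Φ k}` of the representatives — is a joint `λ^k`-eigenvector of `⋀^{2k} μ_{g • Φ}(λ)` for every `g ∈ G`
and `λ ∈ ℂ` (typer-2's dictionary `isHodgeSetProd_iff_forall_map_cocharOn_eq`). -/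
theorem reducedWedge_mem_jointEigenspaceOn [Fintype J] {c : G} (hc : IsComplexConj c) {Φ : J → Finset G}
    (hΦ : ∀ k, IsCMType c (Φ k)) {cls : ι → J} {tw : ι → G}
    (hinj : Function.Injective fun i => (cls i, tw i)) {k : ℕ} (hsum : SumP k (corner Φ cls tw))
    (e : Fin (2 * k) ≃ ι) (σ : G) :
    coordWedgeOn (2 * k) (reducedEnum cls tw e σ) ∈
      jointEigenspaceOn (fun g : G => prodTypeSet fun j => g • Φ j) (2 * k) k := by
  rw [mem_jointEigenspaceOn_iff]
  have hH : IsHodgeSetProd c Φ (univ.image (reducedEnum cls tw e σ)) := by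
    rw [image_reducedEnum]
    exact isHodgeSetProd_reducedSet_of_sumP hc Φ hinj hsum σ
  exact (isHodgeSetProd_iff_forall_map_cocharOn_eq hc hΦ (reducedEnum_injective hinj e σ)).1 hH

/-! ### Lemma R's combinatorial core at level `k` on the coset `G`-set of `B_red` -/

omit [Fintype G] [DecidableEq ι] in
/-- **g0's `isHodgeSetOn_cosetMap_reducedSet` at every level**: for a `SumP k` corner family with pairwise
distinct `(cls, tw)` and `cosetMap Φ` injective on `U_σ`, the image `cosetMap Φ (U_σ)` is a Pohlmann set of the
type `cosetType Φ` of the reduced product `B_red = ∏_k Simple (Φ k)` (typer's `IsTypeMap` transfer along g0's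
`cosetMap`). -/
theorem isHodgeSetOn_cosetMap_reducedSet_of_sumP [Fintype J] {c : G} (hc : IsComplexConj c)
    (Φ : J → Finset G) {cls : ι → J} {tw : ι → G} (hinj : Function.Injective fun i => (cls i, tw i))
    {k : ℕ} (hsum : SumP k (corner Φ cls tw)) (σ : G)
    (hρ : Set.InjOn (cosetMap Φ) (reducedSet cls tw σ)) :
    IsHodgeSetOn c (cosetType Φ) ((reducedSet cls tw σ).image (cosetMap Φ)) := by
  rw [(isTypeMap_cosetMap Φ).isHodgeSetOn_image_iff c _ hρ]
  exact isHodgeSetProd_reducedSet_of_sumP hc Φ hinj hsum σ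

/-- The enumeration of `cosetMap Φ (U_σ)` by `Fin (2k)`: `cosetMap Φ ∘ reducedEnum cls tw e σ`. -/
def cosetEnum (Φ : J → Finset G) (cls : ι → J) (tw : ι → G) {k : ℕ} (e : Fin (2 * k) ≃ ι) (σ : G) :
    Fin (2 * k) → cosetSet Φ :=
  cosetMap Φ ∘ reducedEnum cls tw e σ

omit [DecidableEq G] [Fintype G] [Fintype ι] [DecidableEq ι] [DecidableEq J] in
/-- **g0's `weilEnum` is the coset enumeration at `k = 2`** (`ι = Fin 4`, `e = Equiv.refl`): the reduced-side
Weil line of `Night1WeilLineEigen` is the `k = 2` instance of this file's objects. -/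
theorem weilEnum_eq_cosetEnum (Φ : J → Finset G) (cls : Fin 4 → J) (tw : Fin 4 → G) (σ : G) :
    weilEnum Φ cls tw σ = cosetEnum Φ cls tw (Equiv.refl (Fin (2 * 2))) σ := rfl

omit [Fintype G] [DecidableEq ι] in
/-- The image of the coset enumeration is `cosetMap Φ (U_σ)`. -/
theorem image_cosetEnum (Φ : J → Finset G) (cls : ι → J) (tw : ι → G) {k : ℕ} (e : Fin (2 * k) ≃ ι)
    (σ : G) : univ.image (cosetEnum Φ cls tw e σ) = (reducedSet cls tw σ).image (cosetMap Φ) := by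
  rw [cosetEnum, ← image_image, image_reducedEnum]

omit [Fintype G] [DecidableEq ι] in
/-- The coset enumeration is injective when `(cls, tw)` is injective and `cosetMap Φ` is injective on `U_σ`. -/
theorem cosetEnum_injective (Φ : J → Finset G) {cls : ι → J} {tw : ι → G}
    (hinj : Function.Injective fun i => (cls i, tw i)) {k : ℕ} (e : Fin (2 * k) ≃ ι) (σ : G)
    (hρ : Set.InjOn (cosetMap Φ) (reducedSet cls tw σ)) : Function.Injective (cosetEnum Φ cls tw e σ) := by
  intro j j' h
  have hj : reducedEnum cls tw e σ j ∈ reducedSet cls tw σ := by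
    rw [← image_reducedEnum cls tw e σ]
    exact mem_image_of_mem _ (mem_univ j)
  have hj' : reducedEnum cls tw e σ j' ∈ reducedSet cls tw σ := by
    rw [← image_reducedEnum cls tw e σ]
    exact mem_image_of_mem _ (mem_univ j')
  exact reducedEnum_injective hinj e σ (hρ hj hj' h)

omit [DecidableEq ι] in
/-- **The level-`k` eigenspace form on the coset `G`-set of `B_red`** (g0's `weilWedge_mem_jointEigenspaceOn`
at every level): for a `SumP k` corner family with pairwise distinct `(cls, tw)` and `cosetMap Φ` injective on
`U_σ`, the coordinate wedge of `cosetMap Φ (U_σ)` — the `σ`-line of `W_F(B)` read on `B_red` — is a joint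
`λ^k`-eigenvector of `⋀^{2k} μ_{g • cosetType Φ}(λ)` for every `g ∈ G` and `λ ∈ ℂ`: a `(k, k)`-class of
`B_red` and of every Galois conjugate. -/
theorem cosetWedge_mem_jointEigenspaceOn [Fintype J] {c : G} (hc : IsComplexConj c) {Φ : J → Finset G}
    (hΦ : ∀ k, IsCMType c (Φ k)) {cls : ι → J} {tw : ι → G}
    (hinj : Function.Injective fun i => (cls i, tw i)) {k : ℕ} (hsum : SumP k (corner Φ cls tw))
    (e : Fin (2 * k) ≃ ι) (σ : G) (hρ : Set.InjOn (cosetMap Φ) (reducedSet cls tw σ)) :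
    coordWedgeOn (2 * k) (cosetEnum Φ cls tw e σ) ∈
      jointEigenspaceOn (fun g : G => g • cosetType Φ) (2 * k) k := by
  rw [mem_jointEigenspaceOn_iff]
  have hH : IsHodgeSetOn c (cosetType Φ) (univ.image (cosetEnum Φ cls tw e σ)) := by
    rw [image_cosetEnum]
    exact isHodgeSetOn_cosetMap_reducedSet_of_sumP hc Φ hinj hsum σ hρ
  exact (isHodgeSetOn_iff_forall_map_cocharOn_smul_eq hc (isCMTypeOn_cosetType hΦ)
    (cosetEnum_injective Φ hinj e σ hρ)).1 hH

/-! ### The decic level-3 witness: six pairwise distinct corners, Lemma R's core at level 3 -/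

/-- typer g5's decic witness as a corner family with trivial twists: `cls = id`, `tw = 1`. -/
theorem level3Witness_corner_eq : corner level3Witness id (fun _ => (1 : C10)) = level3Witness := by
  funext i
  ext x
  rw [mem_corner, inv_one, mul_one]
  exact Iff.rfl

/-- **Lemma R's combinatorial core at level 3 for the decic witness**: with its six pairwise distinct corners
(`level3Witness_injective`) and trivial twists, every reduced set `U_σ` is a Pohlmann set of the product
`∏_i A_{T_i}` of the witness itself (here the representatives ARE the corners). -/
theorem level3Witness_isHodgeSetProd_reducedSet (σ : C10) :
    IsHodgeSetProd cc_C10 level3Witness (reducedSet (ι := Fin 6) id (fun _ => (1 : C10)) σ) :=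
  isHodgeSetProd_reducedSet_of_sumP cc_C10_isComplexConj level3Witness
    (fun i j h => by simpa using congrArg Prod.fst h) (k := 3)
    (by rw [level3Witness_corner_eq]; exact level3Witness_sumThree) σ

end HodgeRepro.RouteC
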